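import Literature.Computability.QuantumComplexity.PathModelK5Sim
import HarnessLib

/-!
# The two-qubit gadget sector of the `k = 5` path model: exact identities on eight strands

Topic `Literature/Computability/QuantumComplexity`; sibling of `PathModelK5Sim.lean` (the exact
sparse simulator over `K5 = ℤ[φ][ζ₅][√τ]`) and `PathModelPairBraids.lean`. For the
`PromiseBQP`-hardness of the Jones polynomial at `k = 5` (Aharonov–Arad 2011, Thm. 3.1) two-qubit
gates are braids on the eight strands of two adjacent 4-strand blocks. We use PURE braids moving a
whole PAIR of strands of the first block around pairs of the second block ("pair monodromies"):
with the time-ordered pair pass `E = σ₄σ₅σ₃σ₄` (1-indexed; 0-indexed letters `3,4,2,3`) of the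
pair at positions `3,4` through the pair at `5,6`, its shift `E₂` by two strands, and
`E⁻¹`,

* `M  = E E` — the second pair of block `a` goes once around the first pair of block `a+1`;
* `M' = E E₂ E₂ E⁻¹` — the same pair goes around the SECOND pair of block `a+1`.

On the code words `enc 00, enc 01, enc 10` both act as the identity EXACTLY (a pair in the vacuum
channel braids trivially with anything: `PathModelPairBraids`), and on `enc 11` they act inside the
two-dimensional sector spanned by `|enc 11⟩` and ONE leakage vector `ℓ'` (supported on four
non-code walks), by the matrices (basis `(enc 11, ℓ')`, `τ = φ - 1`, `ζ = ζ₅`)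

  `π(M) = [[-τ², α], [1, β]]`, `π(M') = [[-τ², α'], [-ζ, β]]`,
  `α = (4φ-7) + (3φ-4)ζ`, `α' = (4φ-7)(1+ζ)`, `β = (3-2φ) + (2-φ)ζ`, `det = ζ̄`.

All of this is established here by `decide +kernel` on the exact simulator plus its correctness
theorem `evalS_applyWordS`; the numbers were found with an external exact replica of the simulator.
These identities are the whole two-qubit content of the hardness reduction: words in `M, M'` give
controlled phase gates `diag(1,1,1,π(w)₁₁)` up to the leakage amplitude `π(w)₂₁`.

## References

* D. Aharonov, I. Arad, New J. Phys. 13 (2011) 035019; arXiv:quant-ph/0605181, §3.2, Thm. 3.1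
  [AharonovArad2011].
* D. Aharonov, V. Jones, Z. Landau, Algorithmica 55 (2009), §3.1 [AharonovJonesLandau2009].
-/

noncomputable section

open Matrix

namespace Literature.Computability.QuantumComplexity

open Cryptography QuadraticAlgebra

namespace Gadget

/-- A walk on eight strands from its list of bits. [folklore] -/
def key (l : List Bool) : QReg (2 * 4) := fun i => l.getD i false

/-- The two-qubit code words on eight strands. [cite: AharonovArad2011, §3.1] -/
def enc2 (b₁ b₂ : Bool) : QReg (2 * 4) := encodeBits (N := 2) fun j => if j = 0 then b₁ else b₂

/-- A letter of a braid word on eight strands (0-indexed generator, sign). [folklore] -/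
def letter (r : ℕ) (hr : r < 2 * 4 - 1) (ε : Bool) : Fin (2 * 4 - 1) × Bool := (⟨r, hr⟩, ε)

/-- **The pair pass `E`** (time-ordered letters `3,4,2,3`, all positive): the pair at positions
`3,4` (0-indexed bits `2,3`) passes through the pair at `5,6`. [cite: AharonovArad2011, §3.2] -/
def wordE : List (Fin (2 * 4 - 1) × Bool) :=
  [letter 3 (by norm_num) true, letter 4 (by norm_num) true, letter 2 (by norm_num) true, letter 3 (by norm_num) true]

/-- `E⁻¹` (reversed letters, negative crossings). [cite: AharonovArad2011, §3.2] -/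
def wordEinv : List (Fin (2 * 4 - 1) × Bool) :=
  [letter 3 (by norm_num) false, letter 2 (by norm_num) false, letter 4 (by norm_num) false, letter 3 (by norm_num) false]

/-- `E₂`: the pair pass shifted by two strands (letters `5,6,4,5`). [cite: AharonovArad2011, §3.2] -/
def wordE2 : List (Fin (2 * 4 - 1) × Bool) :=
  [letter 5 (by norm_num) true, letter 6 (by norm_num) true, letter 4 (by norm_num) true, letter 5 (by norm_num) true]

/-- **`M = E E`**: monodromy of the second pair of block `a` around the first pair of block `a+1`.
[cite: AharonovArad2011, §3.2] -/
def wordM : List (Fin (2 * 4 - 1) × Bool) := wordE ++ wordE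

/-- **`M' = E E₂ E₂ E⁻¹`**: monodromy of the same pair around the second pair of block `a+1`.
[cite: AharonovArad2011, §3.2] -/
def wordM' : List (Fin (2 * 4 - 1) × Bool) := wordE ++ wordE2 ++ wordE2 ++ wordEinv

/-- `E₂⁻¹`. [cite: AharonovArad2011, §3.2] -/
def wordE2inv : List (Fin (2 * 4 - 1) × Bool) :=
  [letter 5 (by norm_num) false, letter 4 (by norm_num) false, letter 6 (by norm_num) false, letter 5 (by norm_num) false]

/-- **`M⁻¹ = E⁻¹ E⁻¹`.** [cite: AharonovArad2011, §3.2] -/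
def wordMinv : List (Fin (2 * 4 - 1) × Bool) := wordEinv ++ wordEinv

/-- **`M'⁻¹ = E E₂⁻¹ E₂⁻¹ E⁻¹`.** [cite: AharonovArad2011, §3.2] -/
def wordM'inv : List (Fin (2 * 4 - 1) × Bool) := wordE ++ wordE2inv ++ wordE2inv ++ wordEinv

/-- The operator of a time-ordered word (first letter acts first). [cite: AharonovJonesLandau2009, Def. 2.14] -/
def op (w : List (Fin (2 * 4 - 1) × Bool)) : Matrix (QReg (2 * 4)) (QReg (2 * 4)) ℂ :=
  (w.reverse.map fun l => ajlCrossingMatrix 5 l).prod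

/-- **The leakage vector `ℓ'`** (sparse, exact): four non-code walks. [cite: AharonovArad2011, §3.2] -/
def leakS : SVec (2 * 4) :=
  [(key [true, true, true, false, true, false, false, false], ⟨⟨⟨0, 0⟩, ⟨0, 0⟩⟩, ⟨⟨-3, 2⟩, ⟨-1, 1⟩⟩⟩),
    (key [true, true, true, false, false, true, false, false], ⟨⟨⟨-5, 3⟩, ⟨-2, 1⟩⟩, ⟨⟨0, 0⟩, ⟨0, 0⟩⟩⟩),
    (key [true, true, false, true, false, true, false, false], ⟨⟨⟨0, 0⟩, ⟨0, 0⟩⟩, ⟨⟨5, -3⟩, ⟨2, -1⟩⟩⟩),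
    (key [true, true, false, true, true, false, false, false], ⟨⟨⟨-5, 3⟩, ⟨-2, 1⟩⟩, ⟨⟨0, 0⟩, ⟨0, 0⟩⟩⟩)]

/-- The leakage vector as a state vector. [cite: AharonovArad2011, §3.2] -/
def leak : QReg (2 * 4) → ℂ := evalS leakS

/-- `-τ² = φ - 2 ∈ K5`. [folklore] -/
def mtau2 : K5 := ⟨⟨⟨-2, 1⟩, ⟨0, 0⟩⟩, ⟨⟨0, 0⟩, ⟨0, 0⟩⟩⟩
/-- `α = (4φ-7) + (3φ-4)ζ`. [cite: AharonovArad2011, §3.2] -/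
def alpha : K5 := ⟨⟨⟨-7, 4⟩, ⟨-4, 3⟩⟩, ⟨⟨0, 0⟩, ⟨0, 0⟩⟩⟩
/-- `α' = (4φ-7)(1+ζ)`. [cite: AharonovArad2011, §3.2] -/
def alpha' : K5 := ⟨⟨⟨-7, 4⟩, ⟨-7, 4⟩⟩, ⟨⟨0, 0⟩, ⟨0, 0⟩⟩⟩
/-- `β = (3-2φ) + (2-φ)ζ`. [cite: AharonovArad2011, §3.2] -/
def beta : K5 := ⟨⟨⟨3, -2⟩, ⟨2, -1⟩⟩, ⟨⟨0, 0⟩, ⟨0, 0⟩⟩⟩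
/-- `-ζ`. [folklore] -/
def mzeta : K5 := ⟨⟨⟨0, 0⟩, ⟨-1, 0⟩⟩, ⟨⟨0, 0⟩, ⟨0, 0⟩⟩⟩
/-- `-ζα = 3φ - 4` (real!). [cite: AharonovArad2011, §3.2] -/
def mzalpha : K5 := ⟨⟨⟨-4, 3⟩, ⟨0, 0⟩⟩, ⟨⟨0, 0⟩, ⟨0, 0⟩⟩⟩
/-- `ζ² = -1 + τζ`. [folklore] -/
def zeta2 : K5 := ⟨⟨⟨-1, 0⟩, ⟨-1, 1⟩⟩, ⟨⟨0, 0⟩, ⟨0, 0⟩⟩⟩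
/-- `-τ²ζ`. [folklore] -/
def mtau2zeta : K5 := ⟨⟨⟨0, 0⟩, ⟨-2, 1⟩⟩, ⟨⟨0, 0⟩, ⟨0, 0⟩⟩⟩

/-- Scale a sparse vector. [folklore] -/
def scaleS {n : ℕ} (L : SVec n) (c : K5) : SVec n := L.map fun t => (t.1, t.2 * c)

/-! ### The exact computations (kernel evaluation of the simulator) -/

/-- `M enc00 = enc00`. [cite: AharonovArad2011, §3.2] -/
theorem simM_enc00 : pruneS (mergeS (applyWordS wordM [(enc2 false false, 1)] ++ [(enc2 false false, -1)])) = [] := by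
  decide +kernel

/-- `M enc01 = enc01`. [cite: AharonovArad2011, §3.2] -/
theorem simM_enc01 : pruneS (mergeS (applyWordS wordM [(enc2 false true, 1)] ++ [(enc2 false true, -1)])) = [] := by
  decide +kernel

/-- `M enc10 = enc10`. [cite: AharonovArad2011, §3.2] -/
theorem simM_enc10 : pruneS (mergeS (applyWordS wordM [(enc2 true false, 1)] ++ [(enc2 true false, -1)])) = [] := by
  decide +kernel

/-- `M enc11 = -τ² enc11 + ℓ'`. [cite: AharonovArad2011, §3.2] -/
theorem simM_enc11 :
    pruneS (mergeS (applyWordS wordM [(enc2 true true, 1)] ++ [(enc2 true true, -mtau2)] ++ scaleS leakS (-1))) = [] := by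
  decide +kernel

/-- `M ℓ' = α enc11 + β ℓ'`. [cite: AharonovArad2011, §3.2] -/
theorem simM_leak :
    pruneS (mergeS (applyWordS wordM leakS ++ [(enc2 true true, -alpha)] ++ scaleS leakS (-beta))) = [] := by
  decide +kernel

/-- `M' enc00 = enc00`. [cite: AharonovArad2011, §3.2] -/
theorem simM'_enc00 : pruneS (mergeS (applyWordS wordM' [(enc2 false false, 1)] ++ [(enc2 false false, -1)])) = [] := by
  decide +kernel

/-- `M' enc01 = enc01`. [cite: AharonovArad2011, §3.2] -/
theorem simM'_enc01 : pruneS (mergeS (applyWordS wordM' [(enc2 false true, 1)] ++ [(enc2 false true, -1)])) = [] := by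
  decide +kernel

/-- `M' enc10 = enc10`. [cite: AharonovArad2011, §3.2] -/
theorem simM'_enc10 : pruneS (mergeS (applyWordS wordM' [(enc2 true false, 1)] ++ [(enc2 true false, -1)])) = [] := by
  decide +kernel

/-- `M' enc11 = -τ² enc11 - ζ ℓ'`. [cite: AharonovArad2011, §3.2] -/
theorem simM'_enc11 :
    pruneS (mergeS (applyWordS wordM' [(enc2 true true, 1)] ++ [(enc2 true true, -mtau2)] ++ scaleS leakS (-mzeta))) = [] := by
  decide +kernel

/-- `M' ℓ' = α' enc11 + β ℓ'`. [cite: AharonovArad2011, §3.2] -/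
theorem simM'_leak :
    pruneS (mergeS (applyWordS wordM' leakS ++ [(enc2 true true, -alpha')] ++ scaleS leakS (-beta))) = [] := by
  decide +kernel

/-- `M⁻¹ enc00 = enc00`. [cite: AharonovArad2011, §3.2] -/
theorem simMinv_enc00 : pruneS (mergeS (applyWordS wordMinv [(enc2 false false, 1)] ++ [(enc2 false false, -1)])) = [] := by
  decide +kernel

/-- `M⁻¹ enc01 = enc01`. [cite: AharonovArad2011, §3.2] -/
theorem simMinv_enc01 : pruneS (mergeS (applyWordS wordMinv [(enc2 false true, 1)] ++ [(enc2 false true, -1)])) = [] := by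
  decide +kernel

/-- `M⁻¹ enc10 = enc10`. [cite: AharonovArad2011, §3.2] -/
theorem simMinv_enc10 : pruneS (mergeS (applyWordS wordMinv [(enc2 true false, 1)] ++ [(enc2 true false, -1)])) = [] := by
  decide +kernel

/-- `M⁻¹ enc11 = -τ² enc11 - ζ ℓ'`. [cite: AharonovArad2011, §3.2] -/
theorem simMinv_enc11 :
    pruneS (mergeS (applyWordS wordMinv [(enc2 true true, 1)] ++ [(enc2 true true, -mtau2)] ++ scaleS leakS (-mzeta))) = [] := by
  decide +kernel

/-- `M⁻¹ ℓ' = (3φ-4) enc11 - τ²ζ ℓ'`. [cite: AharonovArad2011, §3.2] -/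
theorem simMinv_leak :
    pruneS (mergeS (applyWordS wordMinv leakS ++ [(enc2 true true, -mzalpha)] ++ scaleS leakS (-mtau2zeta))) = [] := by
  decide +kernel

/-- `M'⁻¹ enc00 = enc00`. [cite: AharonovArad2011, §3.2] -/
theorem simM'inv_enc00 : pruneS (mergeS (applyWordS wordM'inv [(enc2 false false, 1)] ++ [(enc2 false false, -1)])) = [] := by
  decide +kernel

/-- `M'⁻¹ enc01 = enc01`. [cite: AharonovArad2011, §3.2] -/
theorem simM'inv_enc01 : pruneS (mergeS (applyWordS wordM'inv [(enc2 false true, 1)] ++ [(enc2 false true, -1)])) = [] := by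
  decide +kernel

/-- `M'⁻¹ enc10 = enc10`. [cite: AharonovArad2011, §3.2] -/
theorem simM'inv_enc10 : pruneS (mergeS (applyWordS wordM'inv [(enc2 true false, 1)] ++ [(enc2 true false, -1)])) = [] := by
  decide +kernel

/-- `M'⁻¹ enc11 = -τ² enc11 + ζ² ℓ'`. [cite: AharonovArad2011, §3.2] -/
theorem simM'inv_enc11 :
    pruneS (mergeS (applyWordS wordM'inv [(enc2 true true, 1)] ++ [(enc2 true true, -mtau2)] ++ scaleS leakS (-zeta2))) = [] := by
  decide +kernel

/-- `M'⁻¹ ℓ' = α enc11 - τ²ζ ℓ'`. [cite: AharonovArad2011, §3.2] -/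
theorem simM'inv_leak :
    pruneS (mergeS (applyWordS wordM'inv leakS ++ [(enc2 true true, -alpha)] ++ scaleS leakS (-mtau2zeta))) = [] := by
  decide +kernel

/-! ### From sparse zero-tests to vector identities -/

/-- A sparse vector whose merged, pruned form is empty denotes `0`. [folklore] -/
theorem evalS_eq_zero_of_pruneS_mergeS {n : ℕ} {L : SVec n} (h : pruneS (mergeS L) = []) : evalS L = 0 := by
  rw [← evalS_mergeS, ← evalS_pruneS, h, evalS_nil]

/-- `evalS (scaleS L c) = c • evalS L`. [folklore] -/
theorem evalS_scaleS {n : ℕ} (L : SVec n) (c : K5) : evalS (scaleS L c) = K5.toComplex c • evalS L :=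
  evalS_map_mul L c

/-- `evalS [(w, c)] = c • |w⟩`. [folklore] -/
theorem evalS_single {n : ℕ} (w : QReg n) (c : K5) : evalS [(w, c)] = K5.toComplex c • basisState w := by
  rw [evalS_cons, evalS_nil, add_zero]

/-- Reading a zero-test `word·v + (-c)•e + (-d)•ℓ = 0` as `op word v = c•e + d•ℓ`. [folklore] -/
theorem op_eq_of_sim {w : List (Fin (2 * 4 - 1) × Bool)} {v : SVec (2 * 4)} {e : QReg (2 * 4)} {c d : K5}
    (h : pruneS (mergeS (applyWordS w v ++ [(e, -c)] ++ scaleS leakS (-d))) = []) :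
    op w *ᵥ evalS v = K5.toComplex c • basisState e + K5.toComplex d • leak := by
  have h0 := evalS_eq_zero_of_pruneS_mergeS h
  rw [evalS_append, evalS_append, evalS_applyWordS, evalS_single, evalS_scaleS, map_neg, map_neg, neg_smul,
    neg_smul] at h0
  rw [op, leak]
  linear_combination (exp := 1) h0

/-- Reading a zero-test `word·v + (-1)•e = 0` as `op word v = e`. [folklore] -/
theorem op_eq_of_sim₁ {w : List (Fin (2 * 4 - 1) × Bool)} {v : SVec (2 * 4)} {e : QReg (2 * 4)}
    (h : pruneS (mergeS (applyWordS w v ++ [(e, -1)])) = []) : op w *ᵥ evalS v = basisState e := by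
  have h0 := evalS_eq_zero_of_pruneS_mergeS h
  rw [evalS_append, evalS_applyWordS, evalS_single, map_neg, map_one, neg_smul, one_smul] at h0
  rw [op]
  exact eq_of_sub_eq_zero (by rw [sub_eq_add_neg]; exact h0)

/-- `evalS [(w, 1)] = |w⟩`. [folklore] -/
theorem evalS_single_one {n : ℕ} (w : QReg n) : evalS [(w, 1)] = basisState w := by
  rw [evalS_single, map_one, one_smul]

/-! ### The gadget identities -/

/-- **`M |enc 00⟩ = |enc 00⟩`.** [cite: AharonovArad2011, §3.2] -/
theorem opM_enc00 : op wordM *ᵥ basisState (enc2 false false) = basisState (enc2 false false) := by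
  have h := op_eq_of_sim₁ simM_enc00; rwa [evalS_single_one] at h

/-- **`M |enc 01⟩ = |enc 01⟩`.** [cite: AharonovArad2011, §3.2] -/
theorem opM_enc01 : op wordM *ᵥ basisState (enc2 false true) = basisState (enc2 false true) := by
  have h := op_eq_of_sim₁ simM_enc01; rwa [evalS_single_one] at h

/-- **`M |enc 10⟩ = |enc 10⟩`.** [cite: AharonovArad2011, §3.2] -/
theorem opM_enc10 : op wordM *ᵥ basisState (enc2 true false) = basisState (enc2 true false) := by
  have h := op_eq_of_sim₁ simM_enc10; rwa [evalS_single_one] at h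

/-- **`M |enc 11⟩ = -τ² |enc 11⟩ + ℓ'`.** [cite: AharonovArad2011, §3.2] -/
theorem opM_enc11 :
    op wordM *ᵥ basisState (enc2 true true) = K5.toComplex mtau2 • basisState (enc2 true true) + leak := by
  have h := op_eq_of_sim simM_enc11
  rwa [evalS_single_one, map_one, one_smul] at h

/-- **`M ℓ' = α |enc 11⟩ + β ℓ'`.** [cite: AharonovArad2011, §3.2] -/
theorem opM_leak : op wordM *ᵥ leak = K5.toComplex alpha • basisState (enc2 true true) + K5.toComplex beta • leak :=
  op_eq_of_sim simM_leak

/-- **`M' |enc 00⟩ = |enc 00⟩`.** [cite: AharonovArad2011, §3.2] -/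
theorem opM'_enc00 : op wordM' *ᵥ basisState (enc2 false false) = basisState (enc2 false false) := by
  have h := op_eq_of_sim₁ simM'_enc00; rwa [evalS_single_one] at h

/-- **`M' |enc 01⟩ = |enc 01⟩`.** [cite: AharonovArad2011, §3.2] -/
theorem opM'_enc01 : op wordM' *ᵥ basisState (enc2 false true) = basisState (enc2 false true) := by
  have h := op_eq_of_sim₁ simM'_enc01; rwa [evalS_single_one] at h

/-- **`M' |enc 10⟩ = |enc 10⟩`.** [cite: AharonovArad2011, §3.2] -/
theorem opM'_enc10 : op wordM' *ᵥ basisState (enc2 true false) = basisState (enc2 true false) := by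
  have h := op_eq_of_sim₁ simM'_enc10; rwa [evalS_single_one] at h

/-- **`M' |enc 11⟩ = -τ² |enc 11⟩ - ζ ℓ'`.** [cite: AharonovArad2011, §3.2] -/
theorem opM'_enc11 :
    op wordM' *ᵥ basisState (enc2 true true) = K5.toComplex mtau2 • basisState (enc2 true true) + K5.toComplex mzeta • leak := by
  have h := op_eq_of_sim simM'_enc11
  rwa [evalS_single_one] at h

/-- **`M' ℓ' = α' |enc 11⟩ + β ℓ'`.** [cite: AharonovArad2011, §3.2] -/
theorem opM'_leak : op wordM' *ᵥ leak = K5.toComplex alpha' • basisState (enc2 true true) + K5.toComplex beta • leak :=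
  op_eq_of_sim simM'_leak

/-- **`M⁻¹ |enc 00⟩ = |enc 00⟩`.** [cite: AharonovArad2011, §3.2] -/
theorem opMinv_enc00 : op wordMinv *ᵥ basisState (enc2 false false) = basisState (enc2 false false) := by
  have h := op_eq_of_sim₁ simMinv_enc00; rwa [evalS_single_one] at h

/-- **`M⁻¹ |enc 01⟩ = |enc 01⟩`.** [cite: AharonovArad2011, §3.2] -/
theorem opMinv_enc01 : op wordMinv *ᵥ basisState (enc2 false true) = basisState (enc2 false true) := by
  have h := op_eq_of_sim₁ simMinv_enc01; rwa [evalS_single_one] at h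

/-- **`M⁻¹ |enc 10⟩ = |enc 10⟩`.** [cite: AharonovArad2011, §3.2] -/
theorem opMinv_enc10 : op wordMinv *ᵥ basisState (enc2 true false) = basisState (enc2 true false) := by
  have h := op_eq_of_sim₁ simMinv_enc10; rwa [evalS_single_one] at h

/-- **`M⁻¹ |enc 11⟩ = -τ² |enc 11⟩ - ζ ℓ'`.** [cite: AharonovArad2011, §3.2] -/
theorem opMinv_enc11 :
    op wordMinv *ᵥ basisState (enc2 true true) = K5.toComplex mtau2 • basisState (enc2 true true) + K5.toComplex mzeta • leak := by
  have h := op_eq_of_sim simMinv_enc11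
  rwa [evalS_single_one] at h

/-- **`M⁻¹ ℓ' = (3φ-4) |enc 11⟩ - τ²ζ ℓ'`.** [cite: AharonovArad2011, §3.2] -/
theorem opMinv_leak :
    op wordMinv *ᵥ leak = K5.toComplex mzalpha • basisState (enc2 true true) + K5.toComplex mtau2zeta • leak :=
  op_eq_of_sim simMinv_leak

/-- **`M'⁻¹ |enc 00⟩ = |enc 00⟩`.** [cite: AharonovArad2011, §3.2] -/
theorem opM'inv_enc00 : op wordM'inv *ᵥ basisState (enc2 false false) = basisState (enc2 false false) := by
  have h := op_eq_of_sim₁ simM'inv_enc00; rwa [evalS_single_one] at h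

/-- **`M'⁻¹ |enc 01⟩ = |enc 01⟩`.** [cite: AharonovArad2011, §3.2] -/
theorem opM'inv_enc01 : op wordM'inv *ᵥ basisState (enc2 false true) = basisState (enc2 false true) := by
  have h := op_eq_of_sim₁ simM'inv_enc01; rwa [evalS_single_one] at h

/-- **`M'⁻¹ |enc 10⟩ = |enc 10⟩`.** [cite: AharonovArad2011, §3.2] -/
theorem opM'inv_enc10 : op wordM'inv *ᵥ basisState (enc2 true false) = basisState (enc2 true false) := by
  have h := op_eq_of_sim₁ simM'inv_enc10; rwa [evalS_single_one] at h

/-- **`M'⁻¹ |enc 11⟩ = -τ² |enc 11⟩ + ζ² ℓ'`.** [cite: AharonovArad2011, §3.2] -/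
theorem opM'inv_enc11 :
    op wordM'inv *ᵥ basisState (enc2 true true) = K5.toComplex mtau2 • basisState (enc2 true true) + K5.toComplex zeta2 • leak := by
  have h := op_eq_of_sim simM'inv_enc11
  rwa [evalS_single_one] at h

/-- **`M'⁻¹ ℓ' = α |enc 11⟩ - τ²ζ ℓ'`.** [cite: AharonovArad2011, §3.2] -/
theorem opM'inv_leak :
    op wordM'inv *ᵥ leak = K5.toComplex alpha • basisState (enc2 true true) + K5.toComplex mtau2zeta • leak :=
  op_eq_of_sim simM'inv_leak

/-! ### The constants, evaluated -/

/-- `toComplex mtau2 = -(φ-1)²`. [folklore] -/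
theorem toComplex_mtau2 : K5.toComplex mtau2 = -(((Real.goldenRatio - 1) ^ 2 : ℝ) : ℂ) := by
  have hr : ZPhi.toReal ⟨-2, 1⟩ = -((Real.goldenRatio - 1) ^ 2) := by
    rw [ZPhi.toReal_apply]
    change ((-2 : ℤ) : ℝ) + ((1 : ℤ) : ℝ) * Real.goldenRatio = _
    have h5 : Real.sqrt 5 ^ 2 = 5 := Real.sq_sqrt (by norm_num)
    push_cast
    linear_combination (1 / 4 : ℝ) * h5
  rw [show mtau2 = K5.ofPhi ⟨-2, 1⟩ from rfl, K5.toComplex_ofPhi, hr, Complex.ofReal_neg]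

/-- `toComplex mzeta = -ζ₅ = -A`. [folklore] -/
theorem toComplex_mzeta : K5.toComplex mzeta = -ajlPoint 5 := by
  rw [show mzeta = -K5.zeta from rfl, map_neg, ← ajlPoint_five_eq_toComplex]

end Gadget

end Literature.Computability.QuantumComplexity

end
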